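import Summits.Ventures.GridStability.Lyapunov.K2ALossySplitLinesLPDualData
import Summits.Ventures.GridStability.Lyapunov.K2ALossySplitLinesLPCert
import Literature.MathematicalPhysics.PowerSystems.LuriePostnikovSlabPositivityDual
import HarnessLib

/-!
# «G2.c-K2A-SPLITU-CEILING» — BOTH slab classes on the UNORDERED-LINES split presentation of ★ #22's lossy two-area
# model are EMPTY from `2·arctan(3/80)` (≈ 4.295°) on (file 2 of 2: the LP dual witness over `ℝ` and the theorems)

**OBSTRUCTION row beside «G2.c-K2A-SPLITU».**  For `S = Kundur2A.splitLurieLinesSystem` (MODEL M = `Kundur2A.csgPre.toModelRel (1/10) 0`: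
Chow–Sanchez-Gasca two-area four-machine data, Kron-reduced WITH transfer conductances, h12, unit inertias in scaled time,
uniform damping ratio `1/10` — ★ #22's tokens; Pai's split presentation (3.43), one sine and one cosine channel per ordered
pair, `Models/Kundur2ASplitLurieLines.lean`) and the window `γ₀ = 2·arctan(3/80)` (≈ 4.295°):

* `D : LPSlabDualWitness Kundur2A.splitLurieLinesSystem a0 b0` — lit-6's LP dual witness (`Z ⪰ 0`, (D1) EXACT, (D2), (D3′), (D4)),
  every field from the kernel decisions of file 1 by cast identities;
* `no_lpSplitCertificate_at` / `no_lpSplitCertificate` / `lpSplitClass_empty_K2A` — **no** `Λ : LPSlabCertificate S`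
  (coercivity `P + Cᵀ·diag(λa)·C ⪰ ε·1`, `P` free) satisfies the sector hypothesis of lit-6's LP ROA theorem for the
  window `γ₀`, nor for any window `≥ γ₀`; `no_lpSplitCertificate_perChannel` (windows only on the 24 channels `p ≠ q`);
* `no_splitSlabCertificate_K2A` / `splitSlabClass_empty_K2A` — hence **no** certificate of the class OF RECORD
  (`SlabCertificate S`, `P ⪰ ε·1`) either (`SlabCertificate.false_of_lpDualWitness_of_exists_window`: the positivity
  class contains the class of record);
* `splitClassCeiling_bracket_K2A` — with «G2.c-K2A-SPLITU» (`K2ALossySplitLinesLPCert.lpSplitClass_nonempty_K2A`: an exact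
  positivity certificate at `2·arctan(7/200)` ≈ 4.009°) the split positivity-class optimum on this object lies in
  `(2·arctan(7/200), 2·arctan(3/80)]` = (4.009°, 4.295°] — the class of record inside the same bracket (its exact
  certificate at `7/200` exists in the producer's JSON; VALIDATED);
* `γ7_200_lt_γ₀`, `γ₀_le`, `cos_sin_γ₀` — the windows in closed form.

THREE COLUMNS.  CERTIFIED: «no certificate of either typed split class (`LPSlabCertificate S` ⊇ `SlabCertificate S`
via `toLP`, + `hsec`) certifies a slab half-width `≥ 2·arctan(3/80)` (≈ 4.295°) on ★ #22's model; the positivity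
class is NON-EMPTY at 4.009°».  Against the 9-bus of record (same presentation, same classes): record (8.008°, 8.122°]
(★ #122/#127), positivity (8.464°, 8.578°] (★ #134/«#134′») — on the two-area object the window is HALF as wide and the
positivity lever does not separate the brackets at this grid.  VALIDATED (floats + exact objects, lit-6 kit j292611 /
j292644 / j293272): margins as in file 1; an exact LP dual witness also rounds at `1/25` (4.581°).  MODELLED: as
«G2.c-K2A-SPLITU» / ★ #22.  The sentence is about CERTIFICATE CLASSES, not about the region of attraction of M or of any grid.
[cite: BoydVandenberghe2004, §5.9.4 (5.97)–(5.98), Example 5.14; Khalil2002, §7.1 Example 7.5, §7.1.2 Theorem 7.3; Pai1981, §3.6.3 (3.43)–(3.45), §4.6 p. 117]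
-/

noncomputable section

open Real Matrix
open Literature.Computation.Certificates
open Literature.MathematicalPhysics.PowerSystems
open Literature.MathematicalPhysics.PowerSystems.LyapunovFunctionFamily
open Summit.Ventures.GridStability.Models
open Summit.Ventures.GridStability.Lyapunov.K2ALossySplitLines (e1 eκ e2 AQ CQ BLQ A_eq C_eq B_eq)

namespace Summit.Ventures.GridStability.Lyapunov.K2ALossySplitLinesLPDual

/-! ### Cast plumbing (the parent files' copies are private) -/

/-- `(M + N) ↦ ℝ` (cast plumbing). -/ private theorem map_add' {m n : Type*} (M N : Matrix m n ℚ) :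
    (M + N).map (Rat.cast : ℚ → ℝ) = M.map (Rat.cast : ℚ → ℝ) + N.map (Rat.cast : ℚ → ℝ) := by
  ext i k; simp
/-- `(M − N) ↦ ℝ` (cast plumbing). -/ private theorem map_sub' {m n : Type*} (M N : Matrix m n ℚ) :
    (M - N).map (Rat.cast : ℚ → ℝ) = M.map (Rat.cast : ℚ → ℝ) - N.map (Rat.cast : ℚ → ℝ) := by
  ext i k; simp
/-- `(q • M) ↦ ℝ` (cast plumbing). -/ private theorem map_smul' {m n : Type*} (q : ℚ) (M : Matrix m n ℚ) :
    (q • M).map (Rat.cast : ℚ → ℝ) = ((q : ℚ) : ℝ) • M.map (Rat.cast : ℚ → ℝ) := by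
  ext i k; simp
/-- `(M N) ↦ ℝ` (cast plumbing). -/ private theorem map_mul' {l m n : Type*} [Fintype m] (M : Matrix l m ℚ) (N : Matrix m n ℚ) :
    (M * N).map (Rat.cast : ℚ → ℝ) = M.map (Rat.cast : ℚ → ℝ) * N.map (Rat.cast : ℚ → ℝ) := by
  ext i k; simp [Matrix.mul_apply]
/-- `Mᵀ ↦ ℝ` (cast plumbing). -/ private theorem map_transpose' {m n : Type*} (M : Matrix m n ℚ) :
    Mᵀ.map (Rat.cast : ℚ → ℝ) = (M.map (Rat.cast : ℚ → ℝ))ᵀ := by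
  ext i k; simp

/-! ### The witness data over `ℝ` -/

/-- `Z₁₁ ↦ ℝ`. -/
def Z₁₁ : Matrix (Fin 4 ⊕ Fin 3) (Fin 4 ⊕ Fin 3) ℝ := Z11Q.map (Rat.cast : ℚ → ℝ)
/-- `Z₂₁ ↦ ℝ`. -/
def Z₂₁ : Matrix ((Fin 4 × Fin 4) ⊕ (Fin 4 × Fin 4)) (Fin 4 ⊕ Fin 3) ℝ := Z21Q.map (Rat.cast : ℚ → ℝ)
/-- `Z₂₂ ↦ ℝ`. -/
def Z₂₂ : Matrix ((Fin 4 × Fin 4) ⊕ (Fin 4 × Fin 4)) ((Fin 4 × Fin 4) ⊕ (Fin 4 × Fin 4)) ℝ := Z22Q.map (Rat.cast : ℚ → ℝ)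
/-- The witness's lower slopes over `ℝ`. -/
def a0 (k : (Fin 4 × Fin 4) ⊕ (Fin 4 × Fin 4)) : ℝ := (a0K k : ℝ)
/-- The witness's upper slopes over `ℝ`. -/
def b0 (k : (Fin 4 × Fin 4) ⊕ (Fin 4 × Fin 4)) : ℝ := (b0K k : ℝ)
/-- The window `γ₀ = 2·arctan(3/80)` (≈ 4.295°). -/
def γ₀ : ℝ := 2 * Real.arctan ((u0Q : ℚ) : ℝ)

/-- `γ₀` is the literal window `2·arctan(3/80)` of the row's name. -/
theorem γ₀_eq : γ₀ = 2 * Real.arctan (3 / 80 : ℝ) := by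
  unfold γ₀; norm_num [u0Q]

/-- `cos γ₀ = cg0Q` (cast form, feeds `hwin`). -/
private theorem cos_γ₀_cast : Real.cos γ₀ = ((cg0Q : ℚ) : ℝ) := by
  unfold γ₀ cg0Q
  rw [Lyapunov.StructurePreserving.cos_two_mul_arctan]
  push_cast
  ring

/-- `sin γ₀ = sg0Q` (cast form, feeds `hwin`). -/
private theorem sin_γ₀_cast : Real.sin γ₀ = ((sg0Q : ℚ) : ℝ) := by
  unfold γ₀ sg0Q
  rw [Lyapunov.StructurePreserving.sin_two_mul_arctan]
  push_cast
  ring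

/-- **`cos(2·arctan(3/80)) = 6391/6409`**, **`sin = 480/6409`** (closed forms). -/
theorem cos_sin_γ₀ : Real.cos (2 * Real.arctan (3 / 80 : ℝ)) = 6391 / 6409 ∧ Real.sin (2 * Real.arctan (3 / 80 : ℝ)) = 480 / 6409 := by
  rw [← γ₀_eq, cos_γ₀_cast, sin_γ₀_cast]; constructor <;> norm_num [cg0Q, sg0Q, u0Q]

/-- `0 ≤ γ₀ < π/2`. -/
private theorem γ₀_range : 0 ≤ γ₀ ∧ γ₀ < π / 2 := by
  have hu : (0 : ℝ) ≤ ((u0Q : ℚ) : ℝ) := by exact_mod_cast u0Q_pos_lt.1.le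
  have hu1 : ((u0Q : ℚ) : ℝ) < 1 := by exact_mod_cast u0Q_pos_lt.2
  exact ⟨Lyapunov.StructurePreserving.two_mul_arctan_nonneg hu,
    Lyapunov.StructurePreserving.two_mul_arctan_lt_pi_div_two hu1⟩

/-- `γ₀ ≤ 3 / 40` rad (`arctan u ≤ u`). -/
theorem γ₀_le : γ₀ ≤ 3 / 40 := by
  unfold γ₀
  have h : Real.arctan ((u0Q : ℚ) : ℝ) ≤ ((u0Q : ℚ) : ℝ) :=
    Lyapunov.StructurePreserving.arctan_le_self (by exact_mod_cast u0Q_pos_lt.1.le)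
  have : ((u0Q : ℚ) : ℝ) = 3 / 80 := by norm_num [u0Q]
  linarith

/-! ### `Z ⪰ 0` and (D1) over `ℝ` -/

/-- The receptacle's block matrix is `ZQ ↦ ℝ` (plumbing). -/
private theorem fromBlocks_eq : Matrix.fromBlocks Z₁₁ Z₂₁ᵀ Z₂₁ Z₂₂ = ZQ.map (Rat.cast : ℚ → ℝ) := by
  rw [ZQ, Matrix.fromBlocks_map, Z₁₁, Z₂₁, Z₂₂, map_transpose']

/-- **`Z ⪰ 0`** (feeds `D`). -/
private theorem psd : (Matrix.fromBlocks Z₁₁ Z₂₁ᵀ Z₂₁ Z₂₂).PosSemidef := by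
  rw [fromBlocks_eq]
  have h := (ZQ_ldl.posSemidef (R := ℝ)).submatrix e2
  have e : ((ZQ.submatrix ⇑e2.symm ⇑e2.symm).map (Rat.cast : ℚ → ℝ)).submatrix e2 e2
      = ZQ.map (Rat.cast : ℚ → ℝ) := by
    ext i j; simp
  rwa [e] at h

/-- **`C·B = 0`** on the two-area split object (real form). -/
theorem C_mul_B_K2A : Kundur2A.splitLurieLinesSystem.C * Kundur2A.splitLurieLinesSystem.B = 0 := by
  rw [C_eq, B_eq, ← map_mul', CQ_mul_BLQ_K2A, Matrix.map_zero _ Rat.cast_zero]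

/-- **The adjoint image is rational**: `W + Wᵀ = HQ ↦ ℝ` (plumbing). -/
private theorem adj_eq : dualAdjP Kundur2A.splitLurieLinesSystem Z₁₁ Z₂₁ + (dualAdjP Kundur2A.splitLurieLinesSystem Z₁₁ Z₂₁)ᵀ
    = HQ.map (Rat.cast : ℚ → ℝ) := by
  have hX : dualAdjP Kundur2A.splitLurieLinesSystem Z₁₁ Z₂₁ = XQ.map (Rat.cast : ℚ → ℝ) := by
    rw [dualAdjP, A_eq, B_eq, Z₁₁, Z₂₁, XQ, map_sub', map_add', map_mul', map_mul', map_transpose',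
      map_smul', map_mul', Rat.cast_ofNat]
  rw [hX, HQ, map_add', map_transpose']

/-- **(D1)** `W + Wᵀ ⪰ 0` (feeds `D`). -/
private theorem adjP_psd :
    (dualAdjP Kundur2A.splitLurieLinesSystem Z₁₁ Z₂₁ + (dualAdjP Kundur2A.splitLurieLinesSystem Z₁₁ Z₂₁)ᵀ).PosSemidef := by
  rw [adj_eq]
  have h := (HQ_ldl.posSemidef (R := ℝ)).submatrix e1
  have e : ((HQ.submatrix ⇑e1.symm ⇑e1.symm).map (Rat.cast : ℚ → ℝ)).submatrix e1 e1
      = HQ.map (Rat.cast : ℚ → ℝ) := by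
    ext i j; simp
  rwa [e] at h

/-! ### (D2), (D3′), (D4) and the null channels over `ℝ` -/

/-- The five dual functionals are the casts of `UQ`, `VQ`, `WQ`, `SQ`, `QQ` (the positivity functional
`q_k = (C·W·Cᵀ)_kk` loses its `B`-part because `C·B = 0`). -/
theorem functionals_eq (k : (Fin 4 × Fin 4) ⊕ (Fin 4 × Fin 4)) :
    (Kundur2A.splitLurieLinesSystem.C * Z₁₁ * Kundur2A.splitLurieLinesSystem.Cᵀ) k k = ((UQ k : ℚ) : ℝ) ∧
    (Z₂₁ * Kundur2A.splitLurieLinesSystem.Cᵀ) k k = ((VQ k : ℚ) : ℝ) ∧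
    Z₂₂ k k = ((WQ k : ℚ) : ℝ) ∧
    dualPopovCoeff Kundur2A.splitLurieLinesSystem Z₂₁ Z₂₂ k = ((SQ k : ℚ) : ℝ) ∧
    dualLowerCoeff Kundur2A.splitLurieLinesSystem Z₁₁ Z₂₁ k = ((QQ k : ℚ) : ℝ) := by
  have hCB := C_mul_B_K2A
  refine ⟨?_, ?_, ?_, ?_, ?_⟩
  · rw [C_eq, Z₁₁, ← map_transpose', ← map_mul', ← map_mul', Matrix.map_apply, UQ]
  · rw [C_eq, Z₂₁, ← map_transpose', ← map_mul', Matrix.map_apply, VQ]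
  · rw [Z₂₂, Matrix.map_apply, WQ]
  · rw [dualPopovCoeff, Matrix.mul_assoc, ← Matrix.mul_assoc Kundur2A.splitLurieLinesSystem.C, hCB,
      Matrix.zero_mul, Matrix.zero_apply, sub_zero, C_eq, A_eq, Z₂₁, ← map_mul', ← map_transpose',
      ← map_mul', Matrix.map_apply, SQ]
  · have hsplit : Kundur2A.splitLurieLinesSystem.C * dualAdjP Kundur2A.splitLurieLinesSystem Z₁₁ Z₂₁ * Kundur2A.splitLurieLinesSystem.Cᵀ
        = Kundur2A.splitLurieLinesSystem.C * (Z₁₁ * Kundur2A.splitLurieLinesSystem.Aᵀ + Kundur2A.splitLurieLinesSystem.A * Z₁₁) * Kundur2A.splitLurieLinesSystem.Cᵀ := by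
      rw [dualAdjP, Matrix.mul_sub, Matrix.sub_mul, Matrix.mul_smul, Matrix.smul_mul,
        ← Matrix.mul_assoc Kundur2A.splitLurieLinesSystem.C Kundur2A.splitLurieLinesSystem.B, hCB, Matrix.zero_mul, Matrix.zero_mul, smul_zero, sub_zero]
    rw [dualLowerCoeff, hsplit, C_eq, A_eq, Z₁₁, ← map_transpose', ← map_mul', ← map_mul', ← map_add',
      ← map_mul', ← map_transpose', ← map_mul', Matrix.map_apply, QQ]

/-- **(D2)** at the witness slopes (feeds `D`). -/
private theorem sectorCoeff_nonneg (k : (Fin 4 × Fin 4) ⊕ (Fin 4 × Fin 4)) :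
    0 ≤ dualSectorCoeff Kundur2A.splitLurieLinesSystem Z₁₁ Z₂₁ Z₂₂ a0 b0 k := by
  obtain ⟨hU, hV, hW, -, -⟩ := functionals_eq k
  rw [dualSectorCoeff, hU, hV, hW, a0, b0]
  exact_mod_cast (lpDual_tests k).1

/-- **(D3′)** on every channel: `a0_k · q_k ≤ 2 s_k` (feeds `D`). -/
private theorem lowerPopovCoeff_le (k : (Fin 4 × Fin 4) ⊕ (Fin 4 × Fin 4)) :
    a0 k * dualLowerCoeff Kundur2A.splitLurieLinesSystem Z₁₁ Z₂₁ k ≤ 2 * dualPopovCoeff Kundur2A.splitLurieLinesSystem Z₂₁ Z₂₂ k := by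
  obtain ⟨-, -, -, hS, hQ⟩ := functionals_eq k
  rw [hS, hQ, a0]
  exact_mod_cast (lpDual_tests k).2.1

/-- **(D4a)** `a0 < b0` (feeds `D`). -/
private theorem slope_lt (k : (Fin 4 × Fin 4) ⊕ (Fin 4 × Fin 4)) : a0 k < b0 k := by
  unfold a0 b0; exact_mod_cast (lpDual_tests k).2.2.1

/-- **(D4b)** `tr Z₁₁ > 0` (feeds `D`). -/
private theorem trace_pos : 0 < Matrix.trace Z₁₁ := by
  have h : Matrix.trace Z₁₁ = ((Matrix.trace Z11Q : ℚ) : ℝ) := by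
    simp [Z₁₁, Matrix.trace, Rat.cast_sum]
  rw [h]; exact_mod_cast trace_test

/-- **THE LP DUAL WITNESS** against the Lur'e–Postnikov POSITIVITY certificate class on `S = Kundur2A.splitLurieLinesSystem` at the
window-extreme slopes `(a0, b0)` of the window `γ₀ = 2·arctan(3/80)`.
[cite: BoydVandenberghe2004, §5.9.4 (5.97)–(5.98), Example 5.14; Khalil2002, §7.1 Example 7.5] -/
def D : LPSlabDualWitness Kundur2A.splitLurieLinesSystem a0 b0 where
  Z₁₁ := Z₁₁
  Z₂₁ := Z₂₁
  Z₂₂ := Z₂₂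
  psd := psd
  adjP_psd := adjP_psd
  sectorCoeff_nonneg := sectorCoeff_nonneg
  lowerPopovCoeff_le := lowerPopovCoeff_le
  slope_lt := slope_lt
  trace_pos := trace_pos

/-- The diagonal channels (both families) are NULL for the LP witness (five vanishing functionals). -/
private theorem isNull_diag (k : (Fin 4 × Fin 4) ⊕ (Fin 4 × Fin 4)) (hk : (pairOf k).1 = (pairOf k).2) : D.IsNull k := by
  obtain ⟨hU, hV, hW, hS, hQ⟩ := functionals_eq k
  obtain ⟨h1, h2, h3, h4, h5⟩ := (lpDual_tests k).2.2.2 hk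
  refine ⟨⟨?_, ?_, ?_, ?_⟩, ?_⟩
  · show (Kundur2A.splitLurieLinesSystem.C * Z₁₁ * Kundur2A.splitLurieLinesSystem.Cᵀ) k k = 0; rw [hU]; exact_mod_cast h1
  · show (Z₂₁ * Kundur2A.splitLurieLinesSystem.Cᵀ) k k = 0; rw [hV]; exact_mod_cast h2
  · show Z₂₂ k k = 0; rw [hW]; exact_mod_cast h3
  · show dualPopovCoeff Kundur2A.splitLurieLinesSystem Z₂₁ Z₂₂ k = 0; rw [hS]; exact_mod_cast h4
  · show dualLowerCoeff Kundur2A.splitLurieLinesSystem Z₁₁ Z₂₁ k = 0; rw [hQ]; exact_mod_cast h5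

/-! ### The window points of the 24 channels `p ≠ q` (exact cosines; `ξ = 0` on the wide lines) -/

/-- The two window end points `δ ± γ` and their cosines from `(cos δ, sin δ) = (cδ, sδ)`, `(cos γ, sin γ) = (c, s)`. -/
private theorem window_points {δ γ cδ sδ c s : ℝ} (hc : Real.cos δ = cδ) (hs : Real.sin δ = sδ)
    (hcg : Real.cos γ = c) (hsg : Real.sin γ = s) (hγ : 0 ≤ γ) :
    (∃ ξ, |ξ - δ| ≤ γ ∧ Real.cos ξ = cδ * c - sδ * s) ∧ (∃ ξ, |ξ - δ| ≤ γ ∧ Real.cos ξ = cδ * c + sδ * s) :=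
  ⟨⟨δ + γ, by simp [abs_of_nonneg hγ], by rw [Real.cos_add, hc, hs, hcg, hsg]⟩,
    ⟨δ - γ, by simp [abs_of_nonneg hγ], by rw [Real.cos_sub, hc, hs, hcg, hsg]⟩⟩

/-- The centre `ξ = 0` lies in the window `|ξ − δ| ≤ γ` as soon as `cos γ ≤ cos δ` (`|δ| < π/2`, `0 ≤ γ < π/2`), and
`cos 0 = 1`. -/
private theorem center_point {δ γ cδ c : ℝ} (hδ : |δ| < π / 2) (hγ0 : 0 ≤ γ) (_hγ : γ < π / 2)
    (hc : Real.cos δ = cδ) (hcg : Real.cos γ = c) (hle : c ≤ cδ) :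
    ∃ ξ, |ξ - δ| ≤ γ ∧ Real.cos ξ = 1 := by
  refine ⟨0, ?_, Real.cos_zero⟩
  rw [zero_sub, abs_neg]
  by_contra hlt
  push Not at hlt
  have h1 : Real.cos |δ| < Real.cos γ :=
    Real.cos_lt_cos_of_nonneg_of_le_pi hγ0 (by linarith [abs_nonneg δ, Real.pi_pos]) hlt
  rw [Real.cos_abs, hc, hcg] at h1
  linarith

/-- **`hwin`**: every channel is NULL or has window points `ξa`, `ξb` in `|ξ − δ*_k| ≤ γ₀` with `cos ξa ≤ a0_k`,
`b0_k ≤ cos ξb` — the end points `δ*_k ± γ₀` (or the centre `0` on the wide lines), whose exact cosines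
`window_tests_sin/_cos` compare with `a0/b0` in the kernel. -/
private theorem hwin : ∀ k, D.IsNull k ∨
    ((∃ ξ, |ξ - Kundur2A.splitLurieLinesSystem.δs k| ≤ γ₀ ∧ Real.cos ξ ≤ a0 k) ∧
      ∃ ξ, |ξ - Kundur2A.splitLurieLinesSystem.δs k| ≤ γ₀ ∧ b0 k ≤ Real.cos ξ) := by
  rintro (⟨p, q⟩ | ⟨p, q⟩)
  · by_cases hpq : p = q
    · exact Or.inl (isNull_diag _ hpq)
    right
    have hδs : Kundur2A.splitLurieLinesSystem.δs (Sum.inl (p, q)) = Kundur2A.csgPre.angleOf p - Kundur2A.csgPre.angleOf q := rfl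
    obtain ⟨⟨ξ₁, hξ₁, hc₁⟩, ξ₂, hξ₂, hc₂⟩ := window_points (Kundur2A.cos_angleOf_sub p q)
      (Kundur2A.sin_angleOf_sub p q) cos_γ₀_cast sin_γ₀_cast γ₀_range.1
    obtain ⟨hlo, hhi⟩ := window_tests_sin p q hpq
    rw [hδs]
    refine ⟨?_, ?_⟩
    · rcases hlo with h | h
      · exact ⟨ξ₁, hξ₁, by rw [hc₁, a0]; exact_mod_cast h⟩
      · exact ⟨ξ₂, hξ₂, by rw [hc₂, a0]; exact_mod_cast h⟩
    · rcases hhi with (h | h) | ⟨hw, hb⟩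
      · exact ⟨ξ₁, hξ₁, by rw [hc₁, b0]; exact_mod_cast h⟩
      · exact ⟨ξ₂, hξ₂, by rw [hc₂, b0]; exact_mod_cast h⟩
      · obtain ⟨ξ₀, hξ₀, hc₀⟩ := center_point (Kundur2A.abs_angle_sub_lt p q) γ₀_range.1 γ₀_range.2
          (Kundur2A.cos_angleOf_sub p q) cos_γ₀_cast (by exact_mod_cast hw)
        exact ⟨ξ₀, hξ₀, by rw [hc₀, b0]; exact_mod_cast hb⟩
  · by_cases hpq : p = q
    · exact Or.inl (isNull_diag _ hpq)
    right
    have hδs : Kundur2A.splitLurieLinesSystem.δs (Sum.inr (p, q)) = Kundur2A.csgPre.angleOf p - Kundur2A.csgPre.angleOf q + π / 2 := rfl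
    have hc : Real.cos (Kundur2A.csgPre.angleOf p - Kundur2A.csgPre.angleOf q + π / 2) = -((Kundur2A.csgPre.sd p q : ℚ) : ℝ) := by
      rw [Real.cos_add_pi_div_two, Kundur2A.sin_angleOf_sub]
    have hs : Real.sin (Kundur2A.csgPre.angleOf p - Kundur2A.csgPre.angleOf q + π / 2) = ((Kundur2A.csgPre.cd p q : ℚ) : ℝ) := by
      rw [Real.sin_add_pi_div_two, Kundur2A.cos_angleOf_sub]
    obtain ⟨⟨ξ₁, hξ₁, hc₁⟩, ξ₂, hξ₂, hc₂⟩ := window_points hc hs cos_γ₀_cast sin_γ₀_cast γ₀_range.1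
    obtain ⟨hlo, hhi⟩ := window_tests_cos p q hpq
    rw [hδs]
    refine ⟨?_, ?_⟩
    · rcases hlo with h | h
      · exact ⟨ξ₁, hξ₁, by rw [hc₁, a0]; exact_mod_cast h⟩
      · exact ⟨ξ₂, hξ₂, by rw [hc₂, a0]; exact_mod_cast h⟩
    · rcases hhi with h | h
      · exact ⟨ξ₁, hξ₁, by rw [hc₁, b0]; exact_mod_cast h⟩
      · exact ⟨ξ₂, hξ₂, by rw [hc₂, b0]; exact_mod_cast h⟩

/-! ### THE THEOREMS -/

/-- **No Lur'e–Postnikov POSITIVITY certificate on the split presentation of the lossy two-area model at `γ₀`.**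
No `Λ : LPSlabCertificate Kundur2A.splitLurieLinesSystem` satisfies the sector hypothesis of lit-6's LP ROA theorem on the window
`|ξ − δ*_k| ≤ γ₀ = 2·arctan(3/80)`: the LP dual witness `D` refutes it (weak theorem of alternatives).
[cite: BoydVandenberghe2004, §5.9.4 (5.97)–(5.98), Example 5.14; Khalil2002, §7.1 Example 7.5] -/
theorem no_lpSplitCertificate_at (Λ : LPSlabCertificate Kundur2A.splitLurieLinesSystem)
    (hsec : ∀ k ξ, |ξ - Kundur2A.splitLurieLinesSystem.δs k| ≤ γ₀ → Λ.a k ≤ Real.cos ξ ∧ Real.cos ξ ≤ Λ.b k) :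
    False :=
  Λ.false_of_lpDualWitness_of_exists_window D (γ := fun _ => γ₀) hsec hwin

/-- **No positivity certificate at any window `γ ≥ γ₀`** (the sector hypothesis for `γ` implies it for `γ₀`). -/
theorem no_lpSplitCertificate (Λ : LPSlabCertificate Kundur2A.splitLurieLinesSystem) {γ : ℝ} (hγ : γ₀ ≤ γ)
    (hsec : ∀ k ξ, |ξ - Kundur2A.splitLurieLinesSystem.δs k| ≤ γ → Λ.a k ≤ Real.cos ξ ∧ Real.cos ξ ≤ Λ.b k) :
    False :=
  no_lpSplitCertificate_at Λ fun k ξ hξ => hsec k ξ (hξ.trans hγ)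

/-- **The split positivity class on the two-area object is empty from `γ₀` on** (set form). -/
theorem lpSplitClass_empty_K2A (γ : ℝ) (hγ : γ₀ ≤ γ) :
    ¬ ∃ Λ : LPSlabCertificate Kundur2A.splitLurieLinesSystem,
      ∀ k ξ, |ξ - Kundur2A.splitLurieLinesSystem.δs k| ≤ γ → Λ.a k ≤ Real.cos ξ ∧ Real.cos ξ ≤ Λ.b k :=
  fun ⟨Λ, hsec⟩ => no_lpSplitCertificate Λ hγ hsec

/-- **Per-channel windows**: the refutation needs the window only on the 24 channels `p ≠ q` and only `γ_k ≥ γ₀` there. -/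
theorem no_lpSplitCertificate_perChannel (Λ : LPSlabCertificate Kundur2A.splitLurieLinesSystem) (γ : (Fin 4 × Fin 4) ⊕ (Fin 4 × Fin 4) → ℝ)
    (hγ : ∀ k, (pairOf k).1 ≠ (pairOf k).2 → γ₀ ≤ γ k)
    (hsec : ∀ k ξ, |ξ - Kundur2A.splitLurieLinesSystem.δs k| ≤ γ k → Λ.a k ≤ Real.cos ξ ∧ Real.cos ξ ≤ Λ.b k) :
    False := by
  refine Λ.false_of_lpDualWitness_of_exists_window D (γ := γ) hsec fun k => ?_
  by_cases hk : (pairOf k).1 = (pairOf k).2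
  · exact Or.inl (isNull_diag k hk)
  · rcases hwin k with h | ⟨⟨ξa, hξa, hca⟩, ξb, hξb, hcb⟩
    · exact Or.inl h
    · exact Or.inr ⟨⟨ξa, hξa.trans (hγ k hk), hca⟩, ξb, hξb.trans (hγ k hk), hcb⟩

/-- **No certificate of the class OF RECORD either** (`SlabCertificate S`, `P ⪰ ε·1`; the same LP witness through
`SlabCertificate.false_of_lpDualWitness_of_exists_window`), at any window `≥ γ₀`.
[cite: BoydVandenberghe2004, §5.9.4; Pai1981, §2.16 Theorem [18]] -/
theorem no_splitSlabCertificate_K2A (Λ : SlabCertificate Kundur2A.splitLurieLinesSystem) {γ : ℝ} (hγ : γ₀ ≤ γ)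
    (hsec : ∀ k ξ, |ξ - Kundur2A.splitLurieLinesSystem.δs k| ≤ γ → Λ.a k ≤ Real.cos ξ ∧ Real.cos ξ ≤ Λ.b k) :
    False :=
  Λ.false_of_lpDualWitness_of_exists_window D (γ := fun _ => γ₀)
    (fun k ξ hξ => hsec k ξ (hξ.trans hγ)) hwin

/-- **The split class of record on the two-area object is empty from `γ₀` on** (set form). -/
theorem splitSlabClass_empty_K2A (γ : ℝ) (hγ : γ₀ ≤ γ) :
    ¬ ∃ Λ : SlabCertificate Kundur2A.splitLurieLinesSystem,
      ∀ k ξ, |ξ - Kundur2A.splitLurieLinesSystem.δs k| ≤ γ → Λ.a k ≤ Real.cos ξ ∧ Real.cos ξ ≤ Λ.b k :=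
  fun ⟨Λ, hsec⟩ => no_splitSlabCertificate_K2A Λ hγ hsec

/-- **THE BRACKET on the two-area object**: the split positivity class is NON-EMPTY at `2·arctan(7/200)` (≈ 4.009°,
«G2.c-K2A-SPLITU» `K2ALossySplitLinesLPCert.lpCert`) and EMPTY (with the class of record) at every window
`≥ γ₀ = 2·arctan(3/80)` (≈ 4.295°). -/
theorem splitClassCeiling_bracket_K2A :
    (∃ Λ : LPSlabCertificate Kundur2A.splitLurieLinesSystem,
      ∀ k ξ, |ξ - Kundur2A.splitLurieLinesSystem.δs k| ≤ 2 * Real.arctan (7 / 200 : ℝ) → Λ.a k ≤ Real.cos ξ ∧ Real.cos ξ ≤ Λ.b k) ∧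
    (∀ γ' : ℝ, γ₀ ≤ γ' → ¬ ∃ Λ : LPSlabCertificate Kundur2A.splitLurieLinesSystem,
      ∀ k ξ, |ξ - Kundur2A.splitLurieLinesSystem.δs k| ≤ γ' → Λ.a k ≤ Real.cos ξ ∧ Real.cos ξ ≤ Λ.b k) ∧
    ∀ γ' : ℝ, γ₀ ≤ γ' → ¬ ∃ Λ : SlabCertificate Kundur2A.splitLurieLinesSystem,
      ∀ k ξ, |ξ - Kundur2A.splitLurieLinesSystem.δs k| ≤ γ' → Λ.a k ≤ Real.cos ξ ∧ Real.cos ξ ≤ Λ.b k :=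
  ⟨K2ALossySplitLinesLPCert.lpSplitClass_nonempty_K2A, lpSplitClass_empty_K2A, splitSlabClass_empty_K2A⟩

/-- «G2.c-K2A-SPLITU»'s window lies strictly below this file's: `2·arctan(7/200) < γ₀ = 2·arctan(3/80)`. -/
theorem γ7_200_lt_γ₀ : 2 * Real.arctan (7 / 200 : ℝ) < γ₀ := by
  unfold γ₀
  have h : (7 / 200 : ℝ) < ((u0Q : ℚ) : ℝ) := by norm_num [u0Q]
  have := Real.arctan_strictMono h
  linarith

end Summit.Ventures.GridStability.Lyapunov.K2ALossySplitLinesLPDual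

end
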